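import Summits.CriticalPhenomena.CardyFormulaZ2.Theorems.StripClusterRates.Negative.SubmultiplicativeOne
import Literature.Probability.Percolation.InequalitiesProofs

/-!
# `StripClusterRates` (stmt-CriticalPhenomena-13878): the BK bound `p₂ ≤ p₁²`, the rigorous
# two-sided window for `lim n·γ₁(n)`, and refuted variants of the crux

Negative-side lemmas for the crux `StripClusterRates` (cdisprove unit, cycle 2; part 2 of 3, on top
of `SubmultiplicativeOne.lean` — `rateOne_ge : γ₁(n) ≥ log 2/(n+2)` — and `KacFromAboveFalse`):

* §4 BK: two distinct spanning clusters are two disjointly occurring open crossings, so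
  `p₂(m,n) ≤ p₁(m,n)²` (`pTwo_le_pOne_sq`, van den Berg–Kesten, tree `bk_inequality_holds`) and
  `γ₂(n) ≥ 2γ₁(n)` (`rateTwo_ge_two_mul_rateOne`).
* §5 THE WINDOW: for ANY rate function `γ₁` as in the crux and ANY limit `L` of `n·γ₁(n)`,
  `log 2 ≤ L ≤ 16 log 2` (`nMul_rateOne_limit_mem_window`; upper edge from
  `KacFromAboveFalse.rateOne_odd_width_le`), and any limit `L₂` of `n·γ₂(n)` has `2 log 2 ≤ L₂`
  (`nMul_rateTwo_limit_ge`). The crux's Kac values `π/3 = 1.047…`, `2π` lie strictly inside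
  (`kac_values_in_window`): explicit configurations, self-duality, independence, BK and RSW cannot
  decide the crux in either direction; what they DO exclude is every identification
  `lim n·γ₁(n) = π·h` with `h < log 2/π = 0.2206…` (e.g. the bulk one-arm value `5/48`,
  `h_{2,2} = 1/8`) or `h > 16 log 2/π = 3.53…`, and `lim n·γ₂(n) = π·h'` with `h' < 2 log 2/π = 0.441…`.
* §6 REFUTED VARIANTS, as `¬`-theorems on the crux's statement with other constants:
  `not_stripClusterRates_variant_of_lt_log_two` (`c₁ < log 2`), `_of_gt` (`c₁ > 16 log 2`),
  `_of_lt_two_mul` (`c₂ < 2c₁`, BK), `_of_lt_two_log_two` (`c₂ < 2 log 2`), `_bulkOneArm` (`c₁ = 5π/48`).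
-/

noncomputable section

open MeasureTheory Filter Topology
open Literature.Probability.LatticeModels Literature.Probability.Percolation

namespace Summit.CriticalPhenomena.CardyFormulaZ2.Theorems.StripClusterRates.Negative

open Summit.CriticalPhenomena.CardyFormulaZ2.Theses.CardyBoundaryCoulombGas (StripClusterRates)

/-! ## §4 BK: `p₂ ≤ p₁²` and `γ₂ ≥ 2γ₁` -/

/-- **Two distinct spanning clusters are two disjointly occurring crossings** (lattice
configurations): the edge sets of the two open paths are disjoint open witnesses. [folklore] -/
theorem twoClusterEvent_subset_disjointOccurrence {m n : ℕ} {ω : BondConfig (Site 2)}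
    (hωE : ω ⊆ (zdGraph 2).edgeSet) (hω : ω ∈ twoClusterEvent m n) :
    ω ∈ lrCrossing m n □ lrCrossing m n := by
  classical
  obtain ⟨x₁, hx₁, y₁, hy₁, x₂, hx₂, y₂, hy₂, h₁, h₂, h₁₂⟩ := hω
  obtain ⟨P₁, hS₁, hE₁⟩ := exists_walk_of_mem_openConnIn hωE h₁
  obtain ⟨P₂, hS₂, hE₂⟩ := exists_walk_of_mem_openConnIn hωE h₂
  have key : ∀ z, z ∈ P₁.support → z ∈ P₂.support → False := fun z hz₁ hz₂ =>
    h₁₂ (PlanarDuality.openConnIn_trans (mem_openConnIn_of_mem_support P₁ hS₁ hE₁ hz₁)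
      (by rw [openConnIn_comm]; exact mem_openConnIn_of_mem_support P₂ hS₂ hE₂ hz₂))
  rw [(isUpperSet_lrCrossing m n).mem_disjointOccurrence_iff (isUpperSet_lrCrossing m n)]
  refine ⟨{e | e ∈ P₁.edges}, fun e he => hE₁ e he, {e | e ∈ P₂.edges}, fun e he => hE₂ e he,
    ?_, ?_, ?_⟩
  · rw [Set.disjoint_left]
    intro e he₁ he₂
    simp only [Set.mem_setOf_eq] at he₁ he₂
    induction e using Sym2.ind with
    | _ a b => exact key a (P₁.fst_mem_support_of_mem_edges he₁) (P₂.fst_mem_support_of_mem_edges he₂)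
  · exact ⟨x₁, hx₁, y₁, hy₁, mem_openConnIn_of_walk P₁ hS₁ fun e he => he⟩
  · exact ⟨x₂, hx₂, y₂, hy₂, mem_openConnIn_of_walk P₂ hS₂ fun e he => he⟩

/-- **van den Berg–Kesten: `p₂(m,n) ≤ p₁(m,n)²`.** [folklore] -/
theorem pTwo_le_pOne_sq (m n : ℕ) : pTwo m n ≤ pOne m n ^ 2 := by
  calc pTwo m n ≤ (bondPercolation (zdGraph 2) half).real (lrCrossing m n □ lrCrossing m n) := by
        refine ENNReal.toReal_mono (measure_ne_top _ _) (measure_mono_ae ?_)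
        filter_upwards [ae_subset_edgeSet (zdGraph 2) half] with ω hω h
        exact twoClusterEvent_subset_disjointOccurrence hω h
    _ ≤ pOne m n * pOne m n :=
        bk_inequality_holds (zdGraph 2) half (isUpperSet_lrCrossing m n) (isUpperSet_lrCrossing m n)
          (isLocalEvent_lrCrossing m n) (isLocalEvent_lrCrossing m n)
    _ = pOne m n ^ 2 := by ring

/-- Termwise: `-log p₂(m,n)/m ≥ 2 · (-log p₁(m,n)/m)` (`n ≥ 1`). [folklore] -/
theorem two_mul_rateSeqOne_le (m : ℕ) {n : ℕ} (hn : 1 ≤ n) : 2 * rateSeqOne n m ≤ rateSeqTwo n m := by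
  have hp : 0 < pTwo m n := lt_of_lt_of_le (by positivity) (pTwo_ge hn)
  have hlog : 2 * -Real.log (pOne m n) ≤ -Real.log (pTwo m n) := by
    have := Real.log_le_log hp (pTwo_le_pOne_sq m n)
    rw [Real.log_pow] at this; push_cast at this; linarith
  show 2 * (-Real.log (pOne m n) / (m : ℝ)) ≤ -Real.log (pTwo m n) / (m : ℝ)
  rw [← mul_div_assoc]
  exact div_le_div_of_nonneg_right hlog (by positivity)

/-- **`γ₂(n) ≥ 2 γ₁(n)`** for the limits (`n ≥ 1`). [folklore] -/
theorem rateTwo_ge_two_mul_rateOne {n : ℕ} (hn : 1 ≤ n) {γ₁ γ₂ : ℝ}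
    (h₁ : Tendsto (rateSeqOne n) atTop (𝓝 γ₁)) (h₂ : Tendsto (rateSeqTwo n) atTop (𝓝 γ₂)) :
    2 * γ₁ ≤ γ₂ :=
  le_of_tendsto_of_tendsto (h₁.const_mul 2) h₂ (Eventually.of_forall fun m ↦ two_mul_rateSeqOne_le m hn)

/-! ## §5 The rigorous window for `lim n·γ₁(n)` and `lim n·γ₂(n)` -/

/-- **Lower edge of the window**: for any rate function `γ₁` of the crux and any limit `L` of
`n·γ₁(n)`, `log 2 ≤ L` (self-duality + sub-multiplicativity). [folklore] -/
theorem nMul_rateOne_limit_ge {γ₁ : ℕ → ℝ}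
    (h : ∀ n : ℕ, 1 ≤ n → Tendsto (rateSeqOne n) atTop (𝓝 (γ₁ n))) {L : ℝ}
    (hL : Tendsto (fun n : ℕ ↦ (n : ℝ) * γ₁ n) atTop (𝓝 L)) : Real.log 2 ≤ L := by
  -- n log 2/(n+2) → log 2
  have hcmp : Tendsto (fun n : ℕ ↦ (n : ℝ) * (Real.log 2 / (n + 2))) atTop (𝓝 (Real.log 2)) := by
    have h1 : Tendsto (fun n : ℕ ↦ Real.log 2 / (1 + 2 / (n : ℝ))) atTop (𝓝 (Real.log 2 / (1 + 0))) := by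
      refine tendsto_const_nhds.div (tendsto_const_nhds.add ?_) (by norm_num)
      exact tendsto_const_nhds.div_atTop tendsto_natCast_atTop_atTop
    rw [add_zero, div_one] at h1
    refine h1.congr' ?_
    filter_upwards [eventually_ge_atTop 1] with n hn
    have : (n : ℝ) ≠ 0 := by exact_mod_cast Nat.one_le_iff_ne_zero.mp hn
    field_simp
  refine le_of_tendsto_of_tendsto hcmp hL ?_
  filter_upwards [eventually_ge_atTop 1] with n hn
  exact mul_le_mul_of_nonneg_left (rateOne_ge (h n hn)) (by positivity)

/-- **Upper edge of the window** (RSW, from `KacFromAboveFalse.rateOne_odd_width_le`): any limit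
`L` of `n·γ₁(n)` satisfies `L ≤ 16 log 2` (along odd widths `n = 2j+1`,
`n·γ₁(n) ≤ (2j+1)·8 log 2/(j+1) ≤ 16 log 2`). [folklore] -/
theorem nMul_rateOne_limit_le {γ₁ : ℕ → ℝ}
    (h : ∀ n : ℕ, 1 ≤ n → Tendsto (rateSeqOne n) atTop (𝓝 (γ₁ n))) {L : ℝ}
    (hL : Tendsto (fun n : ℕ ↦ (n : ℝ) * γ₁ n) atTop (𝓝 L)) : L ≤ 16 * Real.log 2 := by
  have hodd : Tendsto (fun j : ℕ ↦ 2 * j + 1) atTop atTop := by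
    refine tendsto_atTop_mono (fun j ↦ ?_) tendsto_id
    simp only [id]; omega
  refine le_of_tendsto' (hL.comp hodd) fun j ↦ ?_
  have hγ := rateOne_odd_width_le (h (2 * j + 1) (by omega))
  have hl : 0 < Real.log 2 := Real.log_pos one_lt_two
  have hj : (0 : ℝ) < (j : ℝ) + 1 := by positivity
  show ((2 * j + 1 : ℕ) : ℝ) * γ₁ (2 * j + 1) ≤ 16 * Real.log 2
  calc ((2 * j + 1 : ℕ) : ℝ) * γ₁ (2 * j + 1) ≤ ((2 * j + 1 : ℕ) : ℝ) * (8 * Real.log 2 / (j + 1)) :=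
        mul_le_mul_of_nonneg_left hγ (by positivity)
    _ ≤ 16 * Real.log 2 := by
        rw [mul_div_assoc', div_le_iff₀ hj]; push_cast; nlinarith

/-- **THE WINDOW**: `log 2 ≤ lim n·γ₁(n) ≤ 16 log 2`, i.e. `L ∈ [0.693…, 11.09…]`, for every rate
function and every limit; the crux claims `L = π/3 = 1.047…`. [folklore] -/
theorem nMul_rateOne_limit_mem_window {γ₁ : ℕ → ℝ}
    (h : ∀ n : ℕ, 1 ≤ n → Tendsto (rateSeqOne n) atTop (𝓝 (γ₁ n))) {L : ℝ}
    (hL : Tendsto (fun n : ℕ ↦ (n : ℝ) * γ₁ n) atTop (𝓝 L)) :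
    Real.log 2 ≤ L ∧ L ≤ 16 * Real.log 2 :=
  ⟨nMul_rateOne_limit_ge h hL, nMul_rateOne_limit_le h hL⟩

/-- **Lower edge for the two-cluster constant**: any limit `L₂` of `n·γ₂(n)` has `2 log 2 ≤ L₂`
(BK + the window); the crux claims `L₂ = 2π = 6.283…`. [folklore] -/
theorem nMul_rateTwo_limit_ge {γ₁ γ₂ : ℕ → ℝ}
    (h₁ : ∀ n : ℕ, 1 ≤ n → Tendsto (rateSeqOne n) atTop (𝓝 (γ₁ n)))
    (h₂ : ∀ n : ℕ, 1 ≤ n → Tendsto (rateSeqTwo n) atTop (𝓝 (γ₂ n))) {L₂ : ℝ}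
    (hL : Tendsto (fun n : ℕ ↦ (n : ℝ) * γ₂ n) atTop (𝓝 L₂)) : 2 * Real.log 2 ≤ L₂ := by
  have hcmp : Tendsto (fun n : ℕ ↦ (n : ℝ) * (2 * (Real.log 2 / (n + 2)))) atTop (𝓝 (2 * Real.log 2)) := by
    have h1 : Tendsto (fun n : ℕ ↦ 2 * Real.log 2 / (1 + 2 / (n : ℝ))) atTop
        (𝓝 (2 * Real.log 2 / (1 + 0))) := by
      refine tendsto_const_nhds.div (tendsto_const_nhds.add ?_) (by norm_num)
      exact tendsto_const_nhds.div_atTop tendsto_natCast_atTop_atTop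
    rw [add_zero, div_one] at h1
    refine h1.congr' ?_
    filter_upwards [eventually_ge_atTop 1] with n hn
    have : (n : ℝ) ≠ 0 := by exact_mod_cast Nat.one_le_iff_ne_zero.mp hn
    field_simp
  refine le_of_tendsto_of_tendsto hcmp hL ?_
  filter_upwards [eventually_ge_atTop 1] with n hn
  have := rateTwo_ge_two_mul_rateOne hn (h₁ n hn) (h₂ n hn)
  have := rateOne_ge (h₁ n hn)
  exact mul_le_mul_of_nonneg_left (by linarith) (by positivity)

/-- The Kac values claimed by the crux sit strictly inside the rigorous window:
`log 2 < π/3 < 16 log 2` and `2 log 2 < 2π` — none of the handles above can decide the crux. [folklore] -/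
theorem kac_values_in_window :
    Real.log 2 < Real.pi / 3 ∧ Real.pi / 3 < 16 * Real.log 2 ∧ 2 * Real.log 2 < 2 * Real.pi := by
  have h1 := Real.log_two_lt_d9
  have h2 := Real.log_two_gt_d9
  have h3 := Real.pi_gt_three
  have h4 := Real.pi_lt_d2
  refine ⟨by linarith, by linarith, by linarith⟩

/-- In the language of the crux: `StripClusterRates` passes every rigorous check of this file —
recorded as the (true) implication to the window constraints it must satisfy. [folklore] -/
theorem stripClusterRates_respects_window (h : StripClusterRates) :
    ∃ γ₁ γ₂ : ℕ → ℝ, (∀ n : ℕ, 1 ≤ n → Real.log 2 / (n + 2) ≤ γ₁ n ∧ 2 * γ₁ n ≤ γ₂ n ∧ γ₂ n ≤ 3 * Real.log 2) ∧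
      Tendsto (fun n : ℕ ↦ (n : ℝ) * γ₁ n) atTop (𝓝 (Real.pi / 3)) ∧
      Tendsto (fun n : ℕ ↦ (n : ℝ) * γ₂ n) atTop (𝓝 (2 * Real.pi)) := by
  obtain ⟨γ₁, γ₂, h1, h2, h3, h4⟩ := h
  exact ⟨γ₁, γ₂, fun n hn ↦ ⟨rateOne_ge (h1 n hn), rateTwo_ge_two_mul_rateOne hn (h1 n hn) (h2 n hn),
    rateTwo_le hn (h2 n hn)⟩, h3, h4⟩


/-! ## §6 Refuted variants: the crux with other constants

`StripClusterRates` is, definitionally, the instance `c₁ = π/3`, `c₂ = 2π` of the statement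
"∃ γ₁ γ₂, (rates exist for `n ≥ 1`) ∧ n·γ₁(n) → c₁ ∧ n·γ₂(n) → c₂" refuted below for every
`c₁ < log 2`, `c₁ > 16 log 2`, `c₂ < 2c₁` and `c₂ < 2 log 2` (statements inlined). -/

/-- **Refuted variant**: no one-cluster constant `c₁ < log 2` (whatever `c₂`). [folklore] -/
theorem not_stripClusterRates_variant_of_lt_log_two {c₁ c₂ : ℝ} (hc : c₁ < Real.log 2) :
    ¬ ∃ γ₁ γ₂ : ℕ → ℝ, (∀ n : ℕ, 1 ≤ n → Tendsto (rateSeqOne n) atTop (𝓝 (γ₁ n))) ∧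
        (∀ n : ℕ, 1 ≤ n → Tendsto (rateSeqTwo n) atTop (𝓝 (γ₂ n))) ∧
        Tendsto (fun n : ℕ ↦ (n : ℝ) * γ₁ n) atTop (𝓝 c₁) ∧
        Tendsto (fun n : ℕ ↦ (n : ℝ) * γ₂ n) atTop (𝓝 c₂) := by
  rintro ⟨γ₁, γ₂, h1, -, h3, -⟩
  have := nMul_rateOne_limit_ge h1 h3
  linarith

/-- **Refuted variant**: no one-cluster constant `c₁ > 16 log 2`. [folklore] -/
theorem not_stripClusterRates_variant_of_gt {c₁ c₂ : ℝ} (hc : 16 * Real.log 2 < c₁) :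
    ¬ ∃ γ₁ γ₂ : ℕ → ℝ, (∀ n : ℕ, 1 ≤ n → Tendsto (rateSeqOne n) atTop (𝓝 (γ₁ n))) ∧
        (∀ n : ℕ, 1 ≤ n → Tendsto (rateSeqTwo n) atTop (𝓝 (γ₂ n))) ∧
        Tendsto (fun n : ℕ ↦ (n : ℝ) * γ₁ n) atTop (𝓝 c₁) ∧
        Tendsto (fun n : ℕ ↦ (n : ℝ) * γ₂ n) atTop (𝓝 c₂) := by
  rintro ⟨γ₁, γ₂, h1, -, h3, -⟩
  have := nMul_rateOne_limit_le h1 h3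
  linarith

/-- **Refuted variant** (BK): the two-cluster constant is at least twice the one-cluster constant;
e.g. `c₁ = π/3` with any `c₂ < 2π/3`. [folklore] -/
theorem not_stripClusterRates_variant_of_lt_two_mul {c₁ c₂ : ℝ} (hc : c₂ < 2 * c₁) :
    ¬ ∃ γ₁ γ₂ : ℕ → ℝ, (∀ n : ℕ, 1 ≤ n → Tendsto (rateSeqOne n) atTop (𝓝 (γ₁ n))) ∧
        (∀ n : ℕ, 1 ≤ n → Tendsto (rateSeqTwo n) atTop (𝓝 (γ₂ n))) ∧
        Tendsto (fun n : ℕ ↦ (n : ℝ) * γ₁ n) atTop (𝓝 c₁) ∧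
        Tendsto (fun n : ℕ ↦ (n : ℝ) * γ₂ n) atTop (𝓝 c₂) := by
  rintro ⟨γ₁, γ₂, h1, h2, h3, h4⟩
  have key : 2 * c₁ ≤ c₂ := by
    refine le_of_tendsto_of_tendsto (h3.const_mul 2) h4 ?_
    filter_upwards [eventually_ge_atTop 1] with n hn
    have := rateTwo_ge_two_mul_rateOne hn (h1 n hn) (h2 n hn)
    have hn0 : (0 : ℝ) ≤ n := by positivity
    nlinarith
  linarith

/-- **Refuted variant**: no two-cluster constant `c₂ < 2 log 2` (whatever `c₁`). [folklore] -/
theorem not_stripClusterRates_variant_of_lt_two_log_two {c₁ c₂ : ℝ} (hc : c₂ < 2 * Real.log 2) :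
    ¬ ∃ γ₁ γ₂ : ℕ → ℝ, (∀ n : ℕ, 1 ≤ n → Tendsto (rateSeqOne n) atTop (𝓝 (γ₁ n))) ∧
        (∀ n : ℕ, 1 ≤ n → Tendsto (rateSeqTwo n) atTop (𝓝 (γ₂ n))) ∧
        Tendsto (fun n : ℕ ↦ (n : ℝ) * γ₁ n) atTop (𝓝 c₁) ∧
        Tendsto (fun n : ℕ ↦ (n : ℝ) * γ₂ n) atTop (𝓝 c₂) := by
  rintro ⟨γ₁, γ₂, h1, h2, -, h4⟩
  have := nMul_rateTwo_limit_ge h1 h2 h4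
  linarith

/-- Example: the misidentification of the one-cluster constant with the bulk one-arm value
`π · 5/48 = 0.327…` is rigorously false, whatever the two-cluster constant. [folklore] -/
theorem not_stripClusterRates_variant_bulkOneArm (c₂ : ℝ) :
    ¬ ∃ γ₁ γ₂ : ℕ → ℝ, (∀ n : ℕ, 1 ≤ n → Tendsto (rateSeqOne n) atTop (𝓝 (γ₁ n))) ∧
        (∀ n : ℕ, 1 ≤ n → Tendsto (rateSeqTwo n) atTop (𝓝 (γ₂ n))) ∧
        Tendsto (fun n : ℕ ↦ (n : ℝ) * γ₁ n) atTop (𝓝 (Real.pi * (5 / 48))) ∧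
        Tendsto (fun n : ℕ ↦ (n : ℝ) * γ₂ n) atTop (𝓝 c₂) := by
  refine not_stripClusterRates_variant_of_lt_log_two ?_
  have := Real.log_two_gt_d9
  have := Real.pi_lt_d2
  nlinarith

end Summit.CriticalPhenomena.CardyFormulaZ2.Theorems.StripClusterRates.Negative
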